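import Mathlib.Algebra.Order.Ring.Abs
import Mathlib.Algebra.Order.Ring.Rat
import Mathlib.Algebra.Order.Field.Basic
import Mathlib.Tactic.Linarith
import Mathlib.Tactic.NormNum
import Mathlib.Tactic.Ring
import Summits.Ventures.CertifiedManyBodySolver.Downfold.PhaseMapCellScore

/-!
# The T_c ORDERING statistic of the material-oracle acceptance test (ACCEPTANCE §4.6, LEVEL 5) as total
# functions: «INSIDE bands are never discordant», symmetry, scale-freeness, and the v1.3 TRUTH-MAXIMUM
# clause evaluated on the LSCO numbers of record

Venture CertifiedManyBodySolver, cell `pub/hubbard-downfold`, seat hubbard-downfold-score-1 (second scoring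
engine); namespace `Summit.Ventures.CertifiedManyBodySolver.Downfold.CellScore` (continues
`PhaseMapCellScore.lean`: `inside`, `tau`). D-0098 A verbatim: «with T_c ordering where known». Everything
here is PROVED (linear arithmetic over `ℚ`).

WHAT THIS IS NOT: not a statement about any material and not the scorer of record (`deputy-2/score.py` v1.3
bb325366 and `validation/score/phasemap.py` 1.3.1 are; both implement §4.6 with the SAME pair loop and agree
on every ordering number of 86 400 synthetic maps, kit j258740). This file is the KERNEL REFERENCE for that
loop and turns two prose sentences of the acceptance text into theorems.

* §1 OBJECTS. A decided member of an ordering group at its reference column is `m : Member` = (measured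
  `Tc`, tolerance `τ`, band `[lo, hi]`). ACCEPTANCE §4.6 verbatim: «CONCORDANT if the bands are disjoint and
  ordered as the measured T_c (requiring |Tc_i − Tc_j| > τ_i + τ_j), DISCORDANT if disjoint and reversed,
  OVERLAPPING otherwise» — `pairClass a b` is the engines' loop body (truth-inseparable ⇒ overlapping; bands
  meet ⇒ overlapping; else concordant iff «a's band above b's» = «a's T_c above b's»). Over a group (list):
  `pairs`, `nClass`, the number of record `orderingScore = concordant / (concordant + discordant)` (`none` =
  n/a without a comparable pair), the v1.3 TRUTH-MAXIMUM membership `isTruthMax top p` («|ΔT_c| ≤ τ_p +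
  τ_top»), `maxMemberDiscordant`, and the §7 rung-1 reading `orderingClause` («≥ 0.80 ∧
  max_member_discordant = 0»; NA below 3 members or without a comparable pair).
* §2 THEOREMS. (a) `pairClass_symm`: for well-formed bands the class does not depend on enumeration order.
  (b) `pairClass_eq_overlapping_of_not_separable` / `_of_not_disjoint` / `_of_nested`: inseparable pairs and
  meeting bands are never counted («wide bands buy no ordering credit»). (c) THE INSIDE ⇒ NO-DISCORDANCE
  THEOREM `pairClass_ne_discordant_of_inside`: two bands that are both INSIDE (§4.4, `Tc ∈ [lo − τ, hi + τ]`)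
  are concordant or overlapping, NEVER discordant; a discordant pair CERTIFIES that one of its bands missed
  (`inside_eq_false_or_of_discordant`) — levels 3 and 5 are not independent numbers. Group form:
  `nClass_discordant_eq_zero_of_forall_inside`, `maxMemberDiscordant_eq_zero_of_forall_inside`,
  `orderingScore_of_forall_inside` (1 or n/a), `orderingClause_ne_FAIL_of_forall_inside` (an all-inside oracle
  loses the §7 ordering clause only by having no comparable pair). (d) SCALE-FREENESS `pairClass_smul` (§4.6
  BECAUSE-line «pair arithmetic, scale-free»). (e) `lt_of_isTruthMax_false`.
* §3 THE LSCO DOME OF RECORD (truth v1.4, P = 0: M14 x=0.07 12.5 ± 4.5 K, M15 x=0.125 29 ± 3, M16 x=0.15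
  38 ± 2, M17 x=0.22 26 ± 4; τ = err): the kernel confirms the §4.6 BECAUSE-arithmetic — (x = 0.125,
  x = 0.22) is truth-inseparable; ONE reversal between x = 0.125 and the optimum x = 0.15 scores 4/5 = 0.80
  under the bare fraction while `maxMemberDiscordant = 1`, so the v1.3 clause FAILS (score-2 scenario S13),
  and the reversed M15 band is the one that is not INSIDE.
Design: `ℚ`, Booleans as the scorers print them, `List.countP`; the engines' «first member attaining the
maximum T_c» is the explicit argument `top`. NOT here: reference-column selection (lowest-P H = 0 SC column)
and group membership — bookkeeping that selects WHICH members enter the statistic.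
-/

namespace Summit.Ventures.CertifiedManyBodySolver.Downfold

namespace CellScore

/-! ## §1 Members, pair classes, the statistic -/

/-- A decided member of an ordering group at its reference column: measured `Tc`, tolerance `τ` (truth file,
§2.3) and the map's non-null band `[lo, hi]` (§4.6). [folklore] -/
structure Member where
  /-- measured critical temperature at the reference column (K) -/
  Tc : ℚ
  /-- tolerance τ(Tc, err) of that column (K) -/
  τ : ℚ
  /-- lower edge of the map's T_c band (K) -/
  lo : ℚ
  /-- upper edge of the map's T_c band (K) -/
  hi : ℚ

/-- The three pair classes of ACCEPTANCE §4.6. [folklore] -/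
inductive PairClass
  /-- bands disjoint, truth-separable, ordered as the measured T_c -/
  | concordant
  /-- bands disjoint, truth-separable, order reversed -/
  | discordant
  /-- truth-inseparable or bands not disjoint: printed beside the score, in no numerator or denominator -/
  | overlapping
  deriving DecidableEq, Repr

/-- truth-separability «|Tc_i − Tc_j| > τ_i + τ_j» (§4.6), a Boolean. [folklore] -/
def separable (a b : Member) : Bool := decide (a.τ + b.τ < |a.Tc - b.Tc|)

/-- the two bands are disjoint (strictly, as both engines test it), a Boolean. [folklore] -/
def disjoint (a b : Member) : Bool := decide (a.hi < b.lo ∨ b.hi < a.lo)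

/-- ACCEPTANCE §4.6 pair class — literally the loop body of both scorers: not separable ⇒ overlapping; not
disjoint ⇒ overlapping; otherwise concordant iff «a predicted above b» = «a measured above b». [folklore] -/
def pairClass (a b : Member) : PairClass :=
  if separable a b = false then .overlapping
  else if disjoint a b = false then .overlapping
  else if decide (b.hi < a.lo) = decide (b.Tc < a.Tc) then .concordant else .discordant

/-- the member's band is INSIDE (§4.4 `CellScore.inside`: `Tc ∈ [lo − τ, hi + τ]`). [folklore] -/
def Member.inside (m : Member) : Bool := CellScore.inside m.lo m.hi m.Tc m.τ

/-- the unordered pairs `(lᵢ, lⱼ)`, `i < j`, of a group, in the engines' enumeration order. [folklore] -/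
def pairs : List Member → List (Member × Member)
  | [] => []
  | a :: l => l.map (fun b => (a, b)) ++ pairs l

/-- number of pairs of a given class. [folklore] -/
def nClass (c : PairClass) (l : List Member) : ℕ := (pairs l).countP (fun p => decide (pairClass p.1 p.2 = c))

/-- ACCEPTANCE §4.6 number of record «ordering = concordant / (concordant + discordant)»; `none` (n/a) when no
pair is comparable. [folklore] -/
def orderingScore (l : List Member) : Option ℚ :=
  if nClass .concordant l + nClass .discordant l = 0 then none
  else some ((nClass .concordant l : ℚ) / (nClass .concordant l + nClass .discordant l : ℚ))

/-- v1.3 TRUTH-MAXIMUM membership relative to the top member: «the top measured T_c … and every member not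
truth-separable from it (|ΔT_c| ≤ τ_i + τ_j)». [folklore] -/
def isTruthMax (top p : Member) : Bool := decide (|p.Tc - top.Tc| ≤ p.τ + top.τ)

/-- v1.3 `max_member_discordant`: discordant pairs containing a truth-maximum member. [folklore] -/
def maxMemberDiscordant (top : Member) (l : List Member) : ℕ :=
  (pairs l).countP (fun p => decide (pairClass p.1 p.2 = .discordant) && (isTruthMax top p.1 || isTruthMax top p.2))

/-- PASS / FAIL / NA, as the §7 clause table prints them. [folklore] -/
inductive Clause
  /-- threshold met -/
  | PASS
  /-- threshold missed -/
  | FAIL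
  /-- not applicable (vacuous) -/
  | NA
  deriving DecidableEq, Repr

/-- the §7 rung-1 ordering clause, v1.3 reading, per group: NA below 3 decided members or without a comparable
pair; else PASS iff «ordering ≥ 0.80 ∧ max_member_discordant = 0». [folklore] -/
def orderingClause (top : Member) (l : List Member) : Clause :=
  if l.length < 3 ∨ nClass .concordant l + nClass .discordant l = 0 then .NA
  else if 4 * (nClass .concordant l + nClass .discordant l) ≤ 5 * nClass .concordant l
          ∧ maxMemberDiscordant top l = 0 then .PASS
  else .FAIL

/-! ## §2 Property sheet -/

section pair
variable {a b : Member}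
/-- `separable` without the absolute value. [folklore] -/
theorem separable_iff : separable a b = true ↔ a.τ + b.τ < a.Tc - b.Tc ∨ a.τ + b.τ < b.Tc - a.Tc := by
  simp only [separable, decide_eq_true_eq, lt_abs, neg_sub]

/-- `disjoint` unfolded. [folklore] -/
theorem disjoint_iff : disjoint a b = true ↔ a.hi < b.lo ∨ b.hi < a.lo := by
  simp only [disjoint, decide_eq_true_eq]

/-- separability is symmetric. [folklore] -/
theorem separable_comm : separable a b = separable b a := by
  rw [Bool.eq_iff_iff, separable_iff, separable_iff, add_comm a.τ b.τ, or_comm]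

/-- disjointness is symmetric. [folklore] -/
theorem disjoint_comm : disjoint a b = disjoint b a := by
  rw [Bool.eq_iff_iff, disjoint_iff, disjoint_iff, or_comm]

/-- A truth-inseparable pair is OVERLAPPING (never counted). [folklore] -/
theorem pairClass_eq_overlapping_of_not_separable (h : separable a b = false) :
    pairClass a b = .overlapping := by
  simp [pairClass, h]

/-- A pair whose bands meet is OVERLAPPING (never counted). [folklore] -/
theorem pairClass_eq_overlapping_of_not_disjoint (h : disjoint a b = false) : pairClass a b = .overlapping := by
  unfold pairClass
  split_ifs <;> rfl

/-- «Wide bands buy no ordering credit»: a band containing the other (well-formed) band is OVERLAPPING with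
it. [folklore] -/
theorem pairClass_eq_overlapping_of_nested (hb : b.lo ≤ b.hi) (h₁ : a.lo ≤ b.lo) (h₂ : b.hi ≤ a.hi) :
    pairClass a b = .overlapping := by
  apply pairClass_eq_overlapping_of_not_disjoint
  rw [Bool.eq_false_iff, Ne, disjoint_iff]
  rintro (h | h) <;> linarith

/-- CONCORDANT ⇔ separable, disjoint, and band order = truth order. [folklore] -/
theorem pairClass_eq_concordant_iff : pairClass a b = .concordant ↔
    separable a b = true ∧ disjoint a b = true ∧ (b.hi < a.lo ↔ b.Tc < a.Tc) := by
  unfold pairClass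
  cases separable a b <;> cases disjoint a b <;> simp [decide_eq_decide]

/-- DISCORDANT ⇔ separable, disjoint, and band order ≠ truth order. [folklore] -/
theorem pairClass_eq_discordant_iff : pairClass a b = .discordant ↔
    separable a b = true ∧ disjoint a b = true ∧ ¬ (b.hi < a.lo ↔ b.Tc < a.Tc) := by
  unfold pairClass
  cases separable a b <;> cases disjoint a b <;> simp [decide_eq_decide]

/-- SYMMETRY: for well-formed bands (`lo ≤ hi`) and non-negative tolerances the pair class does not depend on
the order of enumeration — the statistic is a property of the SET of decided members. [folklore] -/
theorem pairClass_symm (ha : a.lo ≤ a.hi) (hb : b.lo ≤ b.hi) (hτ : 0 ≤ a.τ + b.τ) :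
    pairClass a b = pairClass b a := by
  by_cases hs : separable a b = true
  · by_cases hd : disjoint a b = true
    · have hs' : separable b a = true := separable_comm ▸ hs
      have hd' : disjoint b a = true := disjoint_comm ▸ hd
      -- exactly one band is above the other, exactly one T_c is above the other
      have hband : (b.hi < a.lo) ↔ ¬ (a.hi < b.lo) :=
        ⟨fun h h' => by linarith, fun h => (disjoint_iff.mp hd).resolve_left h⟩
      have htc : (b.Tc < a.Tc) ↔ ¬ (a.Tc < b.Tc) :=
        ⟨fun h h' => by linarith, fun h => by rcases separable_iff.mp hs with h' | h' <;> linarith [not_lt.mp h]⟩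
      by_cases hab : (b.hi < a.lo ↔ b.Tc < a.Tc)
      · have hba : (a.hi < b.lo ↔ a.Tc < b.Tc) := by
          rw [hband, htc] at hab
          exact not_iff_not.mp hab
        rw [pairClass_eq_concordant_iff.mpr ⟨hs, hd, hab⟩, pairClass_eq_concordant_iff.mpr ⟨hs', hd', hba⟩]
      · have hba : ¬ (a.hi < b.lo ↔ a.Tc < b.Tc) := by
          rw [hband, htc] at hab
          exact fun h => hab (not_iff_not.mpr h)
        rw [pairClass_eq_discordant_iff.mpr ⟨hs, hd, hab⟩, pairClass_eq_discordant_iff.mpr ⟨hs', hd', hba⟩]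
    · rw [Bool.not_eq_true] at hd
      rw [pairClass_eq_overlapping_of_not_disjoint hd,
        pairClass_eq_overlapping_of_not_disjoint (disjoint_comm ▸ hd)]
  · rw [Bool.not_eq_true] at hs
    rw [pairClass_eq_overlapping_of_not_separable hs,
      pairClass_eq_overlapping_of_not_separable (separable_comm ▸ hs)]

/-- THE INSIDE ⇒ NO-DISCORDANCE THEOREM (§4.4 ⇒ §4.6): if both bands are INSIDE (`Tc ∈ [lo − τ, hi + τ]`)
the pair is concordant or overlapping — never discordant (no sign condition on τ is even needed: if b's band
lies below a's then b.Tc − τ_b ≤ b.hi < a.lo ≤ a.Tc + τ_a, and separability |ΔT_c| > τ_a + τ_b leaves only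
a.Tc > b.Tc; symmetrically otherwise). [folklore] -/
theorem pairClass_ne_discordant_of_inside (ha : a.inside = true) (hb : b.inside = true) :
    pairClass a b ≠ .discordant := by
  intro h
  obtain ⟨hs, hd, hne⟩ := pairClass_eq_discordant_iff.mp h
  obtain ⟨ha1, ha2⟩ := inside_iff.mp ha
  obtain ⟨hb1, hb2⟩ := inside_iff.mp hb
  apply hne
  constructor
  · intro hlt
    rcases separable_iff.mp hs with h' | h' <;> linarith
  · intro hlt
    rcases disjoint_iff.mp hd with h' | h'
    · rcases separable_iff.mp hs with h'' | h'' <;> linarith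
    · exact h'

/-- As the report reads it: a DISCORDANT pair certifies that at least one of its two bands is not INSIDE
(missed its measured T_c by more than the tolerance). [folklore] -/
theorem inside_eq_false_or_of_discordant (h : pairClass a b = .discordant) :
    a.inside = false ∨ b.inside = false := by
  by_contra hc
  simp only [not_or, Bool.eq_false_iff, ne_eq, not_not] at hc
  exact pairClass_ne_discordant_of_inside hc.1 hc.2 h
end pair

section scale
/-- common rescaling of every temperature of a member (T_c, τ, band edges) by `c`. [folklore] -/
def Member.smul (c : ℚ) (m : Member) : Member := ⟨c * m.Tc, c * m.τ, c * m.lo, c * m.hi⟩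

/-- order-preserving rescaling (kept local: `c * x < c * y ↔ x < y` for `0 < c`). [folklore] -/
private theorem mul_lt_mul_iff_pos {c x y : ℚ} (hc : 0 < c) : c * x < c * y ↔ x < y := by
  refine ⟨fun h => ?_, fun h => by nlinarith⟩
  by_contra h'
  nlinarith [mul_le_mul_of_nonneg_left (not_lt.mp h') hc.le]

/-- SCALE-FREENESS (§4.6 BECAUSE-line «pair arithmetic, scale-free»): rescaling all temperatures of both
members by the same `c > 0` changes no pair class. [folklore] -/
theorem pairClass_smul {c : ℚ} (hc : 0 < c) (a b : Member) :
    pairClass (a.smul c) (b.smul c) = pairClass a b := by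
  have hsep : separable (a.smul c) (b.smul c) = separable a b := by
    rw [Bool.eq_iff_iff, separable_iff, separable_iff]
    simp only [Member.smul, ← mul_sub, ← mul_add, mul_lt_mul_iff_pos hc]
  have hdis : disjoint (a.smul c) (b.smul c) = disjoint a b := by
    rw [Bool.eq_iff_iff, disjoint_iff, disjoint_iff]
    simp only [Member.smul, mul_lt_mul_iff_pos hc]
  have h1 : decide ((b.smul c).hi < (a.smul c).lo) = decide (b.hi < a.lo) := by
    simp only [Member.smul, mul_lt_mul_iff_pos hc]
  have h2 : decide ((b.smul c).Tc < (a.smul c).Tc) = decide (b.Tc < a.Tc) := by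
    simp only [Member.smul, mul_lt_mul_iff_pos hc]
  unfold pairClass
  rw [hsep, hdis, h1, h2]
end scale

section group
variable {l : List Member} {top : Member}
/-- members of an enumerated pair are members of the group. [folklore] -/
theorem mem_of_mem_pairs {p : Member × Member} (h : p ∈ pairs l) : p.1 ∈ l ∧ p.2 ∈ l := by
  induction l with
  | nil => simp [pairs] at h
  | cons a l ih =>
    simp only [pairs, List.mem_append, List.mem_map] at h
    rcases h with ⟨b, hb, rfl⟩ | h
    · exact ⟨by simp, by simp [hb]⟩
    · exact ⟨List.mem_cons_of_mem a (ih h).1, List.mem_cons_of_mem a (ih h).2⟩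

/-- `max_member_discordant` never exceeds the discordant count. [folklore] -/
theorem maxMemberDiscordant_le (top : Member) (l : List Member) :
    maxMemberDiscordant top l ≤ nClass .discordant l := by
  unfold maxMemberDiscordant nClass
  exact List.countP_mono_left (fun p _ hp => by simp only [Bool.and_eq_true] at hp; exact hp.1)

/-- GROUP FORM of the inside ⇒ no-discordance theorem: if every decided member's band is INSIDE the group has
NO discordant pair … [folklore] -/
theorem nClass_discordant_eq_zero_of_forall_inside (hin : ∀ m ∈ l, m.inside = true) :
    nClass .discordant l = 0 := by
  unfold nClass
  rw [List.countP_eq_zero]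
  intro p hp
  obtain ⟨h1, h2⟩ := mem_of_mem_pairs hp
  simpa using pairClass_ne_discordant_of_inside (hin _ h1) (hin _ h2)

/-- … hence `max_member_discordant = 0` whichever member is the top … [folklore] -/
theorem maxMemberDiscordant_eq_zero_of_forall_inside (hin : ∀ m ∈ l, m.inside = true) (top : Member) :
    maxMemberDiscordant top l = 0 :=
  Nat.eq_zero_of_le_zero ((maxMemberDiscordant_le top l).trans
    (nClass_discordant_eq_zero_of_forall_inside hin).le)

/-- … hence the ordering score is 1 or n/a … [folklore] -/
theorem orderingScore_of_forall_inside (hin : ∀ m ∈ l, m.inside = true) :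
    orderingScore l = none ∨ orderingScore l = some 1 := by
  unfold orderingScore
  rw [nClass_discordant_eq_zero_of_forall_inside hin]
  split_ifs with h
  · exact Or.inl rfl
  · exact Or.inr (by rw [Nat.cast_zero, add_zero, div_self (by simpa using h)])

/-- … hence the §7 ordering clause (v1.3 reading) is PASS or NA, never FAIL: an oracle whose every band is
INSIDE can lose the ordering clause only by having no comparable pair, never by discordance. [folklore] -/
theorem orderingClause_ne_FAIL_of_forall_inside (hin : ∀ m ∈ l, m.inside = true) (top : Member) :
    orderingClause top l ≠ .FAIL := by
  unfold orderingClause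
  rw [nClass_discordant_eq_zero_of_forall_inside hin, maxMemberDiscordant_eq_zero_of_forall_inside hin]
  split_ifs with h1 h2
  · simp
  · simp
  · exact absurd ⟨by omega, rfl⟩ h2

/-- The top member is a truth-maximum member (τ_top ≥ 0). [folklore] -/
theorem isTruthMax_self (h : 0 ≤ top.τ) : isTruthMax top top = true := by
  simp only [isTruthMax, sub_self, abs_zero, decide_eq_true_eq]
  linarith

/-- A member that is not truth-maximum lies strictly below the top (the member both engines take as `top`
attains the maximum measured T_c, whence `hle`), by more than τ_p + τ_top. [folklore] -/
theorem lt_of_isTruthMax_false {p : Member} (hle : p.Tc ≤ top.Tc) (h : isTruthMax top p = false) :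
    p.Tc + (p.τ + top.τ) < top.Tc := by
  simp only [isTruthMax, decide_eq_false_iff_not, not_le] at h
  rw [abs_sub_comm, abs_of_nonneg (by linarith)] at h
  linarith
end group

/-! ## §3 The LSCO dome of record (truth v1.4, P = 0: M14 12.5 ± 4.5 K, M15 29 ± 3 K, M16 38 ± 2 K,
M17 26 ± 4 K; τ = max(err, 1 K, 5 %) = err for all four) -/

section lsco
/-- τ of the four LSCO columns is the curator's error. [folklore] -/
example : tau (25 / 2) (9 / 2) = 9 / 2 ∧ tau 29 3 = 3 ∧ tau 38 2 = 2 ∧ tau 26 4 = 4 := by norm_num [tau]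

/-- M14, x = 0.07 (12.5 ± 4.5 K), with an inside band [8, 14]. [folklore] -/
private def m14 : Member := ⟨25 / 2, 9 / 2, 8, 14⟩
/-- M15, x = 0.125 (29 ± 3 K), with the REVERSED band [40, 46] of score-2 scenario S13. [folklore] -/
private def m15r : Member := ⟨29, 3, 40, 46⟩
/-- M16, x = 0.15 = the optimum (38 ± 2 K), with the REVERSED band [30, 36] of S13. [folklore] -/
private def m16r : Member := ⟨38, 2, 30, 36⟩
/-- M17, x = 0.22 (26 ± 4 K), with an inside band [20, 27]. [folklore] -/
private def m17 : Member := ⟨26, 4, 20, 27⟩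

/-- THE SIX PAIRS: (x = 0.125, x = 0.22) is THE truth-inseparable pair (|29 − 26| ≤ 3 + 4) ⇒ overlapping whatever
the bands; the reversed (x = 0.125, x = 0.15) pair is DISCORDANT; the other four are concordant. [folklore] -/
private theorem sixPairs : pairClass m14 m15r = .concordant ∧ pairClass m14 m16r = .concordant ∧
    pairClass m14 m17 = .concordant ∧ pairClass m15r m16r = .discordant ∧ pairClass m15r m17 = .overlapping ∧
    pairClass m16r m17 = .concordant := by
  refine ⟨?_, ?_, ?_, ?_, ?_, ?_⟩ <;> norm_num [pairClass, separable, disjoint, lt_abs, m14, m15r, m16r, m17]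

/-- the top member M16 (38 K) is the only truth-maximum member. [folklore] -/
private theorem truthMax16 : isTruthMax m16r m16r = true ∧ isTruthMax m16r m14 = false ∧
    isTruthMax m16r m15r = false ∧ isTruthMax m16r m17 = false := by
  norm_num [isTruthMax, abs_sub_le_iff, m14, m15r, m16r, m17]

/-- 4 concordant + 1 discordant + 1 overlapping of 6 pairs ⇒ bare score 4/5 = 0.80 (meets the [v1-proposed] 0.80),
but the discordant pair contains the truth maximum ⇒ `max_member_discordant = 1` ⇒ the v1.3 clause FAILS
(score-2 S13: «a dome with its maximum in the wrong place is not the dome»). [folklore] -/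
example : nClass .concordant [m14, m15r, m16r, m17] = 4 ∧ nClass .discordant [m14, m15r, m16r, m17] = 1 ∧
    nClass .overlapping [m14, m15r, m16r, m17] = 1 := by
  simp [nClass, pairs, sixPairs]

example : orderingScore [m14, m15r, m16r, m17] = some (4 / 5) := by
  simp [orderingScore, nClass, pairs, sixPairs]
  norm_num

example : maxMemberDiscordant m16r [m14, m15r, m16r, m17] = 1 ∧ orderingClause m16r [m14, m15r, m16r, m17] = .FAIL := by
  simp [orderingClause, maxMemberDiscordant, nClass, pairs, sixPairs, truthMax16]

/-- … and, as `inside_eq_false_or_of_discordant` demands, one band of the discordant pair is not INSIDE: M15's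
[40, 46] misses 29 ± 3 K (M16's [30, 36] + τ = 2 still reaches 38 K; M14, M17 are inside). [folklore] -/
example : m15r.inside = false ∧ m16r.inside = true ∧ m14.inside = true ∧ m17.inside = true := by
  norm_num [Member.inside, CellScore.inside, m14, m15r, m16r, m17]
end lsco

end CellScore

end Summit.Ventures.CertifiedManyBodySolver.Downfold
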